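import Literature.NumberTheory.GaloisRepresentations.RestrictedRamificationBaseChange
import Literature.NumberTheory.GaloisCohomology.RestrictedRamificationFiniteCohomologyTotallyComplex
import Literature.NumberTheory.GaloisRepresentations.ContinuousCohomologyFiniteTwoDevissage
import Literature.NumberTheory.GaloisRepresentations.ContinuousCohomologyTransport
import Literature.GroupTheory.ProfiniteSubquotients
import Mathlib.NumberTheory.Cyclotomic.Basic
import HarnessLib

/-!
# Harari Cor. 17.17 / Milne ADT I Cor. 4.15 / NSW (8.3.20) at EVERY number field:
# `finite_restrictedCohomology K` DISCHARGED (fields with real places included), by base change to the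
# totally complex cyclotomic layer `K(ζ_q) ⊆ K_S`

Topic `NumberTheory/GaloisCohomology`; namespace `Literature.NumberTheory.GaloisCohomology`.  THEOREMS ONLY
(no definition, no named fact, no `sorry`, no instance; D-0026).  Width seat `bsd-line-x2-p2` g15 of cell
`bsd-eis` (crux 4 `BSDpOnCellC`, stmt-BirchSwinnertonDyer-19034; `--supports`): the PUB conjunct
`Greenberg2006.prop32_cohomology_isCofinitelyGenerated` of the registered `stub_publishedFacts` is, by the
tree's `prop32_cohomology_isCofinitelyGenerated_of_finite_restrictedCohomology`, a theorem as soon as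
`finite_restrictedCohomology K` holds at EVERY number field `K`; the tree proves it at totally complex `K`
(`finite_restrictedCohomology_of_isTotallyComplex`, lane «TATE-EPC-TC»: Hermite, Kummer theory on the
`S`-units, `cd_p G_{K,S} ≤ 2`), and this file removes the hypothesis.

MATHEMATICS (NSW (8.3.20) / Milne I 4.15 for a number field `K` with real places).  Let `S` be finite,
`M` a finite discrete `Γ_K`-module unramified outside `S` with every place dividing `#M` in `S`.  If `M = 0`
there is nothing to prove.  Otherwise let `p ∣ #M` be a prime and `q = 4` (`p = 2`) or `q = p` (`p` odd);
the cyclotomic layer `L = K(ζ_q)` is TOTALLY COMPLEX (it contains a root of unity of order `> 2`) and lies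
in `K_S` (`S ⊇ S_p`, so `N_S` fixes the `p`-power roots of unity, tree
`smul_eq_self_of_mem_ramificationSubgroup_of_pow_eq_one`), i.e. `N_S(K) ≤ res Γ_L`.  By the base change
`G_{L,S_L} ≃ₜ* U := Gal(K_S/L) ≤ G_{K,S}` (`exists_continuousMulEquiv_galoisGroupUnramifiedOutside`, with
`res⁻¹ N_S(K) = N_{S_L}(L)`), Harari 17.17 at `L` gives `Hʳ(U, A)` finite for every finite discrete
`G_{K,S}`-module `A` with `#A` supported on `S` and every `r`; then `Hʳ(G_{K,S}, A)` is finite for all such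
`A` by induction on `r` through `0 → A → Maps(G_{K,S} ⧸ U, A) → Q → 0` (tree `isSES_coindOpen`) and
Shapiro's lemma `Hʳ(G_{K,S}, Maps(G ⧸ U, A)) ≅ Hʳ(U, A)` (tree `shapiroOpenAddEquiv`): the connecting
homomorphism `Hʳ(G, Q) → Hʳ⁺¹(G, A)` has finite source by induction and its image is the kernel of
`Hʳ⁺¹(G, A) → Hʳ⁺¹(G, Maps) ≅ Hʳ⁺¹(U, A)`, finite.  (`r = 0`: `H⁰ ⊆ A`.)

* §1 `IsSES.finite_succ_X₁` — two-out-of-three in every degree (left term), from the tree's connecting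
  homomorphism `IsSES.exists_connectingHom`;
* §2 `isTotallyComplex_of_isPrimitiveRoot` — a number field with a root of unity of order `> 2` is totally
  complex; `ramificationSubgroup_le_range_absGaloisRestrict_cyclotomicField` — `K(ζ_{p^k}) ⊆ K_S` for
  `S ⊇ S_p`;
* §3 **`finite_continuousCohomology_of_baseChange`** — for `L/K` finite with `N_S(K) ≤ res Γ_L` and
  `finite_restrictedCohomology L`: `Hʳ(G_{K,S}, A)` is finite for every finite discrete `G_{K,S}`-module
  `A` with `#A` supported on the finite `S`, every `r`; `finite_restrictedCohomology_of_baseChange` — the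
  same in the `restrictedCohomology` currency of the named fact;
* §4 **`finite_restrictedCohomology_holds (K) : finite_restrictedCohomology K`** for EVERY number field and
  its `∀`-closed form `forall_finite_restrictedCohomology`.

HONEST FRAMING: a textbook theorem (NSW (8.3.20)) now proved at every number field by assembling landed
theorems of the tree; no statement of any Summit, no case of BSD, no crux and no stub is proved here;
0 cells / labels / tiers move.  Sequel: `IwasawaTheory/Greenberg2006/CohomologyCofiniteGenerationDischarged`
(`prop32_cohomology_isCofinitelyGenerated_holds`).

## References
* J. Neukirch, A. Schmidt, K. Wingberg, *Cohomology of Number Fields*, 2nd ed. (2008), (8.3.20) and its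
  proof; VIII §3; I §6 Prop. (1.6.4) (Shapiro). [NeukirchSchmidtWingberg2008]
* D. Harari, *Galois Cohomology and Class Field Theory* (2020), Cor. 17.17 (p. 295). [Harari2020]
* J. S. Milne, *Arithmetic Duality Theorems*, 2nd ed. (2006), I Cor. 4.15, I Lemma 4.14, I §1 (proof of
  Thm. 1.8: `0 → M → M_* → M₁ → 0`). [MilneADT2006]
* J.-P. Serre, *Cohomologie galoisienne* (1994), I §2.2 (long exact sequence), I §2.5 Prop. 10 (Shapiro).
  [SerreGaloisCohomology1997]
-/

noncomputable section

open CategoryTheory Function NumberField Field IsDedekindDomain Topology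
open scoped NumberField

/-! ### §1. Two out of three in every degree: the left term -/

namespace Literature.NumberTheory.GaloisRepresentations

open _root_.TopRep _root_.ContRepresentation _root_.ContinuousCohomology

section TwoOutOfThree

universe u

variable {Γ : Type u} [Group Γ] [TopologicalSpace Γ] [IsTopologicalGroup Γ] [CompactSpace Γ]
variable {M₁ M₂ M₃ : Type u}
  [AddCommGroup M₁] [TopologicalSpace M₁] [DiscreteTopology M₁]
  [AddCommGroup M₂] [TopologicalSpace M₂] [DiscreteTopology M₂]
  [AddCommGroup M₃] [TopologicalSpace M₃] [DiscreteTopology M₃]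
  {ρ₁ : ContinuousRep Γ ℤ M₁} {ρ₂ : ContinuousRep Γ ℤ M₂} {ρ₃ : ContinuousRep Γ ℤ M₃}
  {f : ρ₁.toTopRep ⟶ ρ₂.toTopRep} {g : ρ₂.toTopRep ⟶ ρ₃.toTopRep}

/-- **Two out of three, left term, every degree**: for a short exact sequence `0 → M₁ → M₂ → M₃ → 0` of
discrete modules over a compact group, if `Hⁿ(Γ, M₃)` and `Hⁿ⁺¹(Γ, M₂)` are finite then so is `Hⁿ⁺¹(Γ, M₁)`
(the kernel of `Hⁿ⁺¹(f)` is the image of the connecting homomorphism `δ : Hⁿ(M₃) → Hⁿ⁺¹(M₁)`, tree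
`IsSES.exists_connectingHom`; Mathlib `AddGroup.fintypeOfKerLeRange`).
[cite: SerreGaloisCohomology1997, I §2.2] [cite: MilneADT2006, I §2 (proof of Thm. 2.8)] -/
theorem IsSES.finite_succ_X₁ (h : IsSES f g) (n : ℕ) [h₃ : Finite (continuousCohomology n ρ₃.toTopRep)]
    [h₂ : Finite (continuousCohomology (n + 1) ρ₂.toTopRep)] :
    Finite (continuousCohomology (n + 1) ρ₁.toTopRep) := by
  obtain ⟨δ, hker, -, -, -⟩ := h.exists_connectingHom n
  haveI := Fintype.ofFinite (continuousCohomology n ρ₃.toTopRep)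
  haveI := Fintype.ofFinite (continuousCohomology (n + 1) ρ₂.toTopRep)
  haveI : Fintype (continuousCohomology (n + 1) ρ₁.toTopRep) :=
    AddGroup.fintypeOfKerLeRange δ.toAddMonoidHom
      (cohomologyMap f (n + 1)).hom.toLinearMap.toAddMonoidHom fun c hc => by
        obtain ⟨γ, hγ⟩ := hker c ((AddMonoidHom.mem_ker).1 hc)
        exact ⟨γ, hγ⟩
  exact Finite.of_fintype _

end TwoOutOfThree

end Literature.NumberTheory.GaloisRepresentations

namespace Literature.NumberTheory.GaloisCohomology

open Literature.NumberTheory.GaloisRepresentations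
open Literature.NumberTheory.GaloisRepresentations.DiscreteGaloisModule (restrictedCohomology)
open _root_.TopRep _root_.ContRepresentation _root_.ContinuousCohomology

/-! ### §2. The cyclotomic layer: totally complex and inside `K_S` -/

section Cyclotomic

/-- **A number field containing a root of unity of order `> 2` is totally complex**: a real embedding would
send it to a real root of unity of order `> 2`, but the real numbers of absolute value `1` are `±1`.
[cite: NeukirchANT1999, Ch. I §10 (cyclotomic fields are totally imaginary)] -/
theorem isTotallyComplex_of_isPrimitiveRoot {L : Type} [Field L] [NumberField L] {ζ : L} {m : ℕ}
    (hζ : IsPrimitiveRoot ζ m) (hm : 2 < m) : IsTotallyComplex L := by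
  refine ⟨fun w => ?_⟩
  by_contra hw
  rw [InfinitePlace.not_isComplex_iff_isReal] at hw
  -- the real embedding `ψ : L →+* ℝ` of the real place `w`
  let ψ : L →+* ℝ := InfinitePlace.embedding_of_isReal hw
  have hx : IsPrimitiveRoot (ψ ζ) m := hζ.map_of_injective ψ.injective
  have hm0 : m ≠ 0 := by omega
  -- a real root of unity is `±1`, so `m ∣ 2`
  have h2 : (ψ ζ) ^ 2 = 1 := by
    rcases (pow_eq_one_iff_of_ne_zero hm0).mp hx.pow_eq_one with h | ⟨h, -⟩
    · rw [h, one_pow]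
    · rw [h, neg_one_sq]
  have hdvd : m ∣ 2 := hx.dvd_of_pow_eq_one 2 h2
  have : m ≤ 2 := Nat.le_of_dvd (by norm_num) hdvd
  omega

variable {K : Type} [Field K] [NumberField K]

/-- **The cyclotomic layer lies in `K_S`**: for a prime `p` with `S ⊇ S_p` and `q = p ^ k`, the ramification
subgroup `N_S(K)` lies in the image of `Γ_{K(ζ_q)} → Γ_K` — it fixes the copy of `K(ζ_q)` in `K̄`
(generated over `K` by `q`-th roots of unity, each fixed by `N_S`, tree
`smul_eq_self_of_mem_ramificationSubgroup_of_pow_eq_one`; tree `exists_mem_range_absGaloisRestrict_iff`).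
[cite: NeukirchSchmidtWingberg2008, VIII §3 (proof of (8.3.11): `k(μ_{p^∞}) ⊆ k_S`)] -/
theorem ramificationSubgroup_le_range_absGaloisRestrict_cyclotomicField {p : ℕ} [Fact p.Prime]
    {S : Set (HeightOneSpectrum (𝓞 K))}
    (hSp : ∀ v : HeightOneSpectrum (𝓞 K), ((p : ℕ) : 𝓞 K) ∈ v.asIdeal → v ∈ S) (k : ℕ) :
    ramificationSubgroup K S ≤ (absGaloisRestrict K (CyclotomicField (p ^ k) K)).range := by
  obtain ⟨e, he⟩ := exists_mem_range_absGaloisRestrict_iff K (CyclotomicField (p ^ k) K)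
  intro g hg
  rw [he g]
  intro x
  -- `x` is a polynomial over `K` in `q`-th roots of unity, each fixed by `g`
  have hx := IsCyclotomicExtension.adjoin_roots (S := {p ^ k}) (A := K) (B := CyclotomicField (p ^ k) K) x
  induction hx using Algebra.adjoin_induction with
  | mem b hb =>
    obtain ⟨n, hn, -, hbn⟩ := hb
    rw [Set.mem_singleton_iff] at hn
    subst hn
    have hpow : (e b) ^ p ^ k = 1 := by rw [← map_pow, hbn, map_one]
    exact smul_eq_self_of_mem_ramificationSubgroup_of_pow_eq_one (K := K) hSp hpow hg
  | algebraMap r =>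
    rw [AlgHom.commutes, absoluteGaloisGroup.smul_def]
    exact (absoluteGaloisGroup.toAlgEquiv K g).commutes r
  | add x y _ _ hx hy => rw [map_add, smul_add, hx, hy]
  | mul x y _ _ hx hy => rw [map_mul, smul_mul', hx, hy]

end Cyclotomic

/-! ### §3. Finiteness at `K` from finiteness at a finite extension `L ⊆ K_S` -/

section BaseChange

variable {K : Type} [Field K] [NumberField K] (L : Type) [Field L] [NumberField L] [Algebra K L]
  [FiniteDimensional K L]

/-- **Base change of NSW (8.3.20) along `L ⊆ K_S`, `G_{K,S}`-module currency.**  Let `S` be finite,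
`L/K` finite with `N_S(K) ≤ res Γ_L` (`L ⊆ K_S`), and assume Harari Cor. 17.17 at `L`
(`finite_restrictedCohomology L`).  Then `Hʳ(G_{K,S}, A)` is finite for every finite discrete continuous
`G_{K,S}`-module `A` with every place dividing `#A` in `S`, and every `r`.  Induction on `r`: `r = 0` is
`H⁰ ⊆ A`; for `r + 1` use `0 → A → Maps(G_{K,S} ⧸ U, A) → Q → 0` with `U = Gal(K_S/L)`: `Hʳ(G, Q)` is
finite by induction (`#Q ∣ #A^{[G:U]}`), and `Hʳ⁺¹(G, Maps) ≅ Hʳ⁺¹(U, A) ≅ Hʳ⁺¹(G_{L,S_L}, A)` (Shapiro;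
base change `G_{L,S_L} ≃ₜ* U`) is finite by the hypothesis at `L`, `A` being a `Γ_L`-module unramified
outside `S_L` via `Γ_L → Γ_K ↠ G_{K,S}`.
[cite: NeukirchSchmidtWingberg2008, (8.3.20) (proof) and I §6 Prop. (1.6.4)] [cite: Harari2020, Cor. 17.17]
[cite: MilneADT2006, I §1 (proof of Thm. 1.8), I Lemma 4.14] -/
theorem finite_continuousCohomology_of_baseChange {S : Set (HeightOneSpectrum (𝓞 K))} (hS : S.Finite)
    (hKS : ramificationSubgroup K S ≤ (absGaloisRestrict K L).range)
    (hL : finite_restrictedCohomology L)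
    (A : Type) [AddCommGroup A] [TopologicalSpace A] [DiscreteTopology A] [Finite A]
    (τ : ContinuousRep (GaloisGroupUnramifiedOutside K S) ℤ A)
    (hA : ∀ v : HeightOneSpectrum (𝓞 K), ((Nat.card A : ℕ) : 𝓞 K) ∈ v.asIdeal → v ∈ S) (r : ℕ) :
    Finite (continuousCohomology r τ.toTopRep) := by
  classical
  haveI : Algebra.IsAlgebraic K L := Algebra.IsAlgebraic.of_finite K L
  haveI : TotallyDisconnectedSpace (GaloisGroupUnramifiedOutside K S) :=
    Literature.GroupTheory.ProfiniteSubquotients.totallyDisconnectedSpace_quotient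
      (ramificationSubgroup K S) (ramificationSubgroup_isClosed K S)
  -- the open subgroup `U = Gal(K_S/L)` and the base change `e : G_{L,S_L} ≃ₜ* U`
  set U : Subgroup (GaloisGroupUnramifiedOutside K S) :=
    ((absGaloisRestrict K L).range).map (toUnramifiedQuot K S) with hUdef
  have hU : IsOpen (U : Set (GaloisGroupUnramifiedOutside K S)) :=
    isOpen_map_toUnramifiedQuot_range_absGaloisRestrict L S
  haveI : CompactSpace U :=
    isCompact_iff_compactSpace.mp (Subgroup.isClosed_of_isOpen U hU).isCompact
  obtain ⟨e, he⟩ := exists_continuousMulEquiv_galoisGroupUnramifiedOutside L S hKS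
  have hSL : ({w : HeightOneSpectrum (𝓞 L) | w.under (𝓞 K) ∈ S}).Finite := setOf_under_mem_finite' L hS
  -- the key input: `Hⁿ(U, B)` is finite for every admissible `B`, every `n`
  have hUfin : ∀ (n : ℕ) (B : Type) [AddCommGroup B] [TopologicalSpace B] [DiscreteTopology B] [Finite B]
      (σ : ContinuousRep (GaloisGroupUnramifiedOutside K S) ℤ B),
      (∀ v : HeightOneSpectrum (𝓞 K), ((Nat.card B : ℕ) : 𝓞 K) ∈ v.asIdeal → v ∈ S) →
      Finite (continuousCohomology n (σ.restrict (subgroupIncl U)).toTopRep) := by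
    intro n B _ _ _ _ σ hB
    -- `B` as a `Γ_L`-module through `Γ_L → Γ_K ↠ G_{K,S}`
    let ρ' : DiscreteGaloisModule L B :=
      (σ.restrict (toUnramifiedQuotCont K S)).restrict (absGaloisRestrict K L)
    have hρ' : ∀ x : absoluteGaloisGroup L, ρ' x = σ (toUnramifiedQuot K S (absGaloisRestrict K L x)) :=
      fun _ => rfl
    -- unramified outside `S_L`
    have hker : ramificationSubgroup L {w : HeightOneSpectrum (𝓞 L) | w.under (𝓞 K) ∈ S} ≤ ContinuousRep.ker ρ' := by
      intro x hx
      rw [ContinuousRep.mem_ker, hρ']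
      have h1 : toUnramifiedQuot K S (absGaloisRestrict K L x) = 1 :=
        (QuotientGroup.eq_one_iff _).mpr (absGaloisRestrict_mem_ramificationSubgroup L S hx)
      rw [h1, map_one]
      rfl
    have hur' : GaloisRep.IsUnramifiedOutside {w : HeightOneSpectrum (𝓞 L) | w.under (𝓞 K) ∈ S} ρ' :=
      (DiscreteGaloisModule.isUnramifiedOutside_iff_ramificationSubgroup_le_ker ρ' _).mpr hker
    have hB' : ∀ w : HeightOneSpectrum (𝓞 L), ((Nat.card B : ℕ) : 𝓞 L) ∈ w.asIdeal → w ∈ {w : HeightOneSpectrum (𝓞 L) | w.under (𝓞 K) ∈ S} :=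
      fun w hw => under_mem_of_natCast_mem L hB w hw
    -- Harari 17.17 at `L`
    haveI hfinL : Finite (restrictedCohomology ρ' {w : HeightOneSpectrum (𝓞 L) | w.under (𝓞 K) ∈ S} n) := hL _ hSL B ρ' hur' hB' n
    -- transport along `e : G_{L,S_L} ≃ₜ* U` (the two modules are `B` on both sides)
    have hall : ∀ b : B, b ∈ Representation.invariants
        (ρ'.toRepresentation.comp (ramificationSubgroup L {w : HeightOneSpectrum (𝓞 L) | w.under (𝓞 K) ∈ S}).subtype) := by
      intro b
      rw [DiscreteGaloisModule.invariants_ramificationSubgroup_eq_top ρ' hker]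
      trivial
    -- the actions in terms of `σ`
    have hY : ∀ (x : absoluteGaloisGroup L)
        (w : Representation.invariants (ρ'.toRepresentation.comp (ramificationSubgroup L {w : HeightOneSpectrum (𝓞 L) | w.under (𝓞 K) ∈ S}).subtype)),
        (((ρ'.quotientInvariants (ramificationSubgroup L {w : HeightOneSpectrum (𝓞 L) | w.under (𝓞 K) ∈ S})).toTopRep.ρ
            (x : GaloisGroupUnramifiedOutside L {w : HeightOneSpectrum (𝓞 L) | w.under (𝓞 K) ∈ S}) w :
          Representation.invariants (ρ'.toRepresentation.comp (ramificationSubgroup L {w : HeightOneSpectrum (𝓞 L) | w.under (𝓞 K) ∈ S}).subtype)) : B) =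
          σ (toUnramifiedQuot K S (absGaloisRestrict K L x)) (w : B) :=
      fun x w => rfl
    have hX : ∀ (u : U) (b : B), (σ.restrict (subgroupIncl U)).toTopRep.ρ u b =
        σ (u : GaloisGroupUnramifiedOutside K S) b := fun u b => rfl
    let φ : TopRep.res ((e.symm.symm : GaloisGroupUnramifiedOutside L {w : HeightOneSpectrum (𝓞 L) | w.under (𝓞 K) ∈ S} →ₜ* U) :
        GaloisGroupUnramifiedOutside L {w : HeightOneSpectrum (𝓞 L) | w.under (𝓞 K) ∈ S} →* U) (σ.restrict (subgroupIncl U)).toTopRep ⟶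
        (ρ'.quotientInvariants (ramificationSubgroup L {w : HeightOneSpectrum (𝓞 L) | w.under (𝓞 K) ∈ S})).toTopRep :=
      TopRep.ofHom
        { toLinearMap :=
            { toFun := fun b => ⟨b, hall b⟩
              map_add' := fun _ _ => rfl
              map_smul' := fun _ _ => rfl }
          cont := continuous_of_discreteTopology
          isIntertwining' := fun x => by
            refine ContinuousLinearMap.ext fun b => Subtype.ext ?_
            induction x using QuotientGroup.induction_on with
            | H y =>
              change σ ((e (y : GaloisGroupUnramifiedOutside L {w : HeightOneSpectrum (𝓞 L) | w.under (𝓞 K) ∈ S}) : U) :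
                  GaloisGroupUnramifiedOutside K S) b =
                σ (toUnramifiedQuot K S (absGaloisRestrict K L y)) b
              exact congrArg (fun g => σ g b) (he y) }
    let ψ : TopRep.res ((e.symm : U →ₜ* GaloisGroupUnramifiedOutside L {w : HeightOneSpectrum (𝓞 L) | w.under (𝓞 K) ∈ S}) :
        U →* GaloisGroupUnramifiedOutside L {w : HeightOneSpectrum (𝓞 L) | w.under (𝓞 K) ∈ S}) (ρ'.quotientInvariants (ramificationSubgroup L {w : HeightOneSpectrum (𝓞 L) | w.under (𝓞 K) ∈ S})).toTopRep ⟶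
        (σ.restrict (subgroupIncl U)).toTopRep :=
      TopRep.ofHom
        { toLinearMap :=
            { toFun := fun w => (w : B)
              map_add' := fun _ _ => rfl
              map_smul' := fun _ _ => rfl }
          cont := continuous_of_discreteTopology
          isIntertwining' := fun u => by
            refine ContinuousLinearMap.ext fun w => ?_
            obtain ⟨y, hy⟩ := QuotientGroup.mk_surjective (e.symm u)
            have hu : (u : GaloisGroupUnramifiedOutside K S) = toUnramifiedQuot K S (absGaloisRestrict K L y) := by
              rw [← he y, hy, ContinuousMulEquiv.apply_symm_apply]
            change (((ρ'.quotientInvariants (ramificationSubgroup L {w : HeightOneSpectrum (𝓞 L) | w.under (𝓞 K) ∈ S})).toTopRep.ρ (e.symm u) w :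
                Representation.invariants (ρ'.toRepresentation.comp (ramificationSubgroup L {w : HeightOneSpectrum (𝓞 L) | w.under (𝓞 K) ∈ S}).subtype)) : B) =
              σ (u : GaloisGroupUnramifiedOutside K S) (w : B)
            rw [← hy, hY, ← hu] }
    exact finite_continuousCohomology_of_continuousMulEquiv e.symm φ ψ (fun _ => rfl) n
  -- induction on the degree, for all admissible `A` at once
  induction r generalizing A with
  | zero => exact finite_continuousCohomology_zero (X := τ.toTopRep)
  | succ n ih =>
    haveI : DiscreteTopology (GaloisGroupUnramifiedOutside K S ⧸ U → A) :=
      ContinuousRep.discreteTopology_coindOpen (M := A) U hU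
    have hSES := τ.isSES_coindOpen U hU
    -- the quotient `Q` is admissible
    haveI : Finite ((GaloisGroupUnramifiedOutside K S ⧸ U → A) ⧸ τ.coindOpenConst U hU) :=
      τ.finite_coindOpenQuot U hU
    have hQ : ∀ v : HeightOneSpectrum (𝓞 K),
        ((Nat.card ((GaloisGroupUnramifiedOutside K S ⧸ U → A) ⧸ τ.coindOpenConst U hU) : ℕ) : 𝓞 K) ∈
          v.asIdeal → v ∈ S := by
      intro v hv
      apply hA v
      have hmul := hSES.natCard_X₂
      rw [ContinuousRep.natCard_coindOpen (M := A) U hU] at hmul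
      -- `#A ^ [G:U] = #A · #Q ∈ v`, so `#A ∈ v`
      have hmem : ((Nat.card A : ℕ) : 𝓞 K) ^ U.index ∈ v.asIdeal := by
        rw [← Nat.cast_pow, hmul, Nat.cast_mul]
        exact v.asIdeal.mul_mem_left _ hv
      exact v.isPrime.mem_of_pow_mem _ hmem
    haveI h₃ : Finite (continuousCohomology n (τ.coindOpenQuot U hU).toTopRep) :=
      ih _ (τ.coindOpenQuot U hU) hQ
    -- `Hⁿ⁺¹(G, Maps(G ⧸ U, A)) ≅ Hⁿ⁺¹(U, A)` finite by the key input
    haveI h₂ : Finite (continuousCohomology (n + 1) (τ.coindOpen U hU).toTopRep) :=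
      (τ.finite_continuousCohomology_coindOpen_iff U hU (n + 1)).mpr (hUfin (n + 1) A τ hA)
    exact hSES.finite_succ_X₁ n

/-- **Base change of NSW (8.3.20) along `L ⊆ K_S`, in the currency of the named fact**: for `S` finite,
`L/K` finite with `N_S(K) ≤ res Γ_L` and `finite_restrictedCohomology L`, every finite discrete `Γ_K`-module
`M` unramified outside `S` with every place dividing `#M` in `S` has `Hʳ(G_S, M^{N_S})` finite for every `r`.
[cite: NeukirchSchmidtWingberg2008, (8.3.20)] [cite: Harari2020, Cor. 17.17] -/
theorem finite_restrictedCohomology_of_baseChange {S : Set (HeightOneSpectrum (𝓞 K))} (hS : S.Finite)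
    (hKS : ramificationSubgroup K S ≤ (absGaloisRestrict K L).range)
    (hL : finite_restrictedCohomology L)
    (M : Type) [AddCommGroup M] [TopologicalSpace M] [DiscreteTopology M] [Finite M]
    (ρ : DiscreteGaloisModule K M) (hur : GaloisRep.IsUnramifiedOutside S ρ)
    (hcard : ∀ v : HeightOneSpectrum (𝓞 K), ((Nat.card M : ℕ) : 𝓞 K) ∈ v.asIdeal → v ∈ S) (r : ℕ) :
    Finite (restrictedCohomology ρ S r) := by
  have hker : ramificationSubgroup K S ≤ ContinuousRep.ker ρ :=
    (DiscreteGaloisModule.isUnramifiedOutside_iff_ramificationSubgroup_le_ker ρ S).mp hur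
  have hcardI : Nat.card (Representation.invariants
      (ρ.toRepresentation.comp (ramificationSubgroup K S).subtype)) = Nat.card M :=
    Nat.card_congr (ρ.invariantsRamificationEquiv hker).toEquiv
  exact finite_continuousCohomology_of_baseChange L hS hKS hL _
    (ρ.quotientInvariants (ramificationSubgroup K S)) (fun v hv => hcard v (by rwa [← hcardI])) r

end BaseChange

/-! ### §4. The named fact at every number field -/

section Holds

variable (K : Type) [Field K] [NumberField K]

/-- **HARARI COR. 17.17 / MILNE I COR. 4.15 / NSW (8.3.20) AT EVERY NUMBER FIELD**: the named fact
`finite_restrictedCohomology K` — for `S` finite, `M` a finite discrete `Γ_K`-module unramified outside `S`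
with every place dividing `#M` in `S`, `Hʳ(G_S, M)` is finite for every `r` — HOLDS, real places allowed.
(`M = 0`: trivially; else base change `finite_restrictedCohomology_of_baseChange` to the totally complex
cyclotomic layer `K(ζ_q) ⊆ K_S`, `q ∈ {4, p}` for a prime `p ∣ #M`, where the tree's
`finite_restrictedCohomology_of_isTotallyComplex` applies.)
[cite: Harari2020, Cor. 17.17 (p. 295)] [cite: MilneADT2006, I §4 Cor. 4.15]
[cite: NeukirchSchmidtWingberg2008, (8.3.20)] -/
theorem finite_restrictedCohomology_holds : finite_restrictedCohomology K := by
  intro S hS M _ _ _ _ ρ hur hcard r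
  classical
  by_cases hsub : Subsingleton M
  · -- the zero module
    haveI : Subsingleton (Representation.invariants
        (ρ.toRepresentation.comp (ramificationSubgroup K S).subtype)) :=
      ⟨fun a b => Subtype.ext (Subsingleton.elim _ _)⟩
    cases r with
    | zero => exact finite_restrictedCohomology_zero S ρ
    | succ n =>
      haveI : Subsingleton (restrictedCohomology ρ S (n + 1)) :=
        subsingleton_continuousCohomology_of_subsingleton
          (ρ.quotientInvariants (ramificationSubgroup K S)).toTopRep n
      infer_instance
  -- a prime `p ∣ #M`; `S ⊇ S_p`
  haveI : Nontrivial M := not_subsingleton_iff_nontrivial.1 hsub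
  have hM1 : Nat.card M ≠ 1 := fun h => hsub (Finite.card_le_one_iff_subsingleton.mp h.le)
  obtain ⟨p, hp, hpd⟩ := Nat.exists_prime_and_dvd hM1
  haveI : Fact p.Prime := ⟨hp⟩
  have hSp : ∀ v : HeightOneSpectrum (𝓞 K), ((p : ℕ) : 𝓞 K) ∈ v.asIdeal → v ∈ S := by
    intro v hv
    apply hcard v
    obtain ⟨c, hc⟩ := hpd
    rw [hc, Nat.cast_mul]
    exact v.asIdeal.mul_mem_right _ hv
  -- the cyclotomic layer `L = K(ζ_{p²})` (order `p² > 2`): totally complex, inside `K_S`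
  let L := CyclotomicField (p ^ 2) K
  haveI : NeZero ((p ^ 2 : ℕ) : L) := ⟨by exact_mod_cast pow_ne_zero 2 hp.ne_zero⟩
  have hζ := IsCyclotomicExtension.zeta_spec (p ^ 2) K L
  have hgt : 2 < p ^ 2 := by
    have := hp.two_le
    nlinarith
  haveI : IsTotallyComplex L := isTotallyComplex_of_isPrimitiveRoot hζ hgt
  haveI : FiniteDimensional K L := IsCyclotomicExtension.finite {p ^ 2} K L
  have hKS : ramificationSubgroup K S ≤ (absGaloisRestrict K L).range :=
    ramificationSubgroup_le_range_absGaloisRestrict_cyclotomicField hSp 2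
  exact finite_restrictedCohomology_of_baseChange L hS hKS
    (finite_restrictedCohomology_of_isTotallyComplex (K := L)) M ρ hur hcard r

/-- `∀`-closed form: **Harari Cor. 17.17 holds at every number field.** [cite: Harari2020, Cor. 17.17]
[cite: NeukirchSchmidtWingberg2008, (8.3.20)] -/
theorem forall_finite_restrictedCohomology :
    ∀ (F : Type) [Field F] [NumberField F], finite_restrictedCohomology F :=
  fun F _ _ => finite_restrictedCohomology_holds F

end Holds

end Literature.NumberTheory.GaloisCohomology

end
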